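import Summits.Langlands.Langlands.Theorems.PhantomRMYoshidaResiduallyYoshidaLiftingDualFrameRealisation
import Summits.Langlands.Langlands.Theorems.PhantomRMYoshidaResiduallyYoshidaLiftingAdjugateDualCocycle
import Summits.Langlands.Langlands.Theorems.PhantomRMYoshidaResiduallyYoshidaLiftingRealiserMultiplierResidual
import Summits.Langlands.Langlands.Theorems.PhantomRMYoshidaResiduallyYoshidaLiftingRibetClassUnique
import HarnessLib

/-!
# Route `PhantomRMYoshida`, crux `ResiduallyYoshidaLifting` (stmt-Langlands-13639), line `sector-klingen-split`:
# stub D3 `stub_realisedClassesDual` — the two Ribet invariants of a symplectic realiser are adjugate-dual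

Stub-worker of lead prover-line-stmt-Langlands-13639-c5-0 (continuation c5, skeleton rev 13, sub-goal D3).

**Theorem (`stub_realisedClassesDual`, registered signature verbatim).**  On a non-twist pair `(σ̄, σ̄')` of irreducible
`Γ_ℚ → GL₂(k)` with equal determinants (`p ≠ 2`, `k = k̄` of characteristic `p`), let the symplectic
`ρ : Γ_ℚ → GL₄(ℚ̄_p)` (any multiplier `ν`) realise the non-trivial cocycle `B` in orientation `(σ̄ sub, σ̄' quotient)` through an
integral frame.  With the adjugate-dual cocycle `B'(g) = -(det σ̄ g)⁻¹ • σ̄'(g) · adj(B g) · σ̄(g)`: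
(i) `ρ` realises `B'` in the OPPOSITE orientation `(σ̄' sub, σ̄ quotient)`; (ii) `B'` is not a coboundary there;
(iii) every non-trivial class realised by `ρ` in the opposite orientation is `c • B'` modulo coboundaries, `c ∈ kˣ`.

**Proof (assembly).**  Unfold `ρ.IsSymplecticWithMultiplierFun ν` to `J` alternating with `det J ≠ 0` and
`ρ(g)ᵀ J ρ(g) = ν(g) J` (`isSymplecticWithMultiplierFun_iff_det_ne_zero`); the landed p149860
`Ribet.stub_realiserMultiplierResidual` makes `ν` integral with reduction `det σ̄' = det σ̄ =: d`; the landed D1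
`Fibre.stub_dualFrameRealisation` (p165620) applied to `Γ := Γ_ℚ`, `σ̄.toMonoidHom`, `σ̄'.toMonoidHom`, `ρ.toMonoidHom` and
`d g := GeneralLinearGroup.det (σ̄ g)` gives (i); (ii) is the coboundary equivalence of the landed D2
`Fibre.stub_adjugateDualCocycle` (p164728); (iii) is the landed uniqueness p142701 `Ribet.stub_realisedClassUnique` for the SWAPPED
pair `(σ̄', σ̄)` (non-conjugate because the pair is non-twist: a conjugator `g σ̄' g⁻¹ = σ̄` gives the twist `g⁻¹ σ̄ g = 1 • σ̄'`),
with the dual frame of (i) as first realiser.  No new definitions, no named fact taken as a hypothesis.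
-/

noncomputable section

-- `Summit.Langlands.Langlands.…` (summit = sub-problem name, D-0017 layout) trips `dupNamespace` on every decl.
set_option linter.dupNamespace false
set_option autoImplicit false

open IsDedekindDomain Filter
open scoped Matrix
open Literature.NumberTheory.GaloisRepresentations Literature.NumberTheory.Automorphic

namespace Summit.Langlands.Langlands.Cruxes.ResiduallyYoshidaLifting.SectorKlingenSplit.Fibre

/-- A NON-TWIST ordered pair `(σ̄, σ̄')` (`σ̄'` is no pointwise-scalar twist of a conjugate of `σ̄`) is non-conjugate in the
SWAPPED order: no `g` with `g σ̄'(x) g⁻¹ = σ̄(x)` for all `x` (else `g⁻¹ σ̄(x) g = 1 • σ̄'(x)`). [folklore] -/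
theorem not_conj_swap_of_not_twist {k : Type*} [Field k] {Γ : Type*} (σ σ' : Γ → GL (Fin 2) k)
    (hnt : ¬ ∃ g : GL (Fin 2) k, ∀ x, ∃ c : k, (g * σ x * g⁻¹).val = c • (σ' x).val) :
    ¬ ∃ g : GL (Fin 2) k, ∀ x, g * σ' x * g⁻¹ = σ x := by
  rintro ⟨g, hg⟩
  refine hnt ⟨g⁻¹, fun x => ⟨1, ?_⟩⟩
  have e : g⁻¹ * σ x * g⁻¹⁻¹ = σ' x := by
    rw [← hg x]
    group
  rw [e, one_smul]

/-- **Registered sub-goal D3 `stub_realisedClassesDual`** (crux stmt-Langlands-13639, line `sector-klingen-split`, skeleton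
rev 13; the lead's assembly of D1 `stub_dualFrameRealisation` + D2 `stub_adjugateDualCocycle` + p149860
`stub_realiserMultiplierResidual` + uniqueness p142701 `stub_realisedClassUnique`): THE TWO RIBET INVARIANTS OF A SYMPLECTIC
REALISER ARE ADJUGATE-DUAL.  On a non-twist pair with equal determinants and irreducible constituents (`p ≠ 2`, `k`
algebraically closed), let the symplectic `ρ` (any multiplier) realise the non-trivial class `B` in orientation
`(σ̄ sub, σ̄' quotient)`.  Then (i) `ρ` realises the adjugate-dual cocycle `B'(g) = -(det σ̄ g)⁻¹ • σ̄'(g) adj(B g) σ̄(g)` in the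
OPPOSITE orientation, (ii) `B'` is not a coboundary there, and (iii) every non-trivial class realised by `ρ` in the opposite
orientation is projectively `B'` modulo coboundaries: the invariant of `ρ` is ONE projective class, read in either orientation.
[folklore] -/
theorem stub_realisedClassesDual :
    ∀ (p : ℕ) [Fact p.Prime], p ≠ 2 → ∀ (k : Type) [Field k] [CharP k p] [IsAlgClosed k]
      [TopologicalSpace k] [DiscreteTopology k] (red : Valued.integer (PadicAlgCl p) →+* k)
      (σ σ' : FramedGaloisRep ℚ k 2) (ρ : FramedGaloisRep ℚ (PadicAlgCl p) 4)
      (B : Field.absoluteGaloisGroup ℚ → Matrix (Fin 2) (Fin 2) k) (ν : Field.absoluteGaloisGroup ℚ → PadicAlgCl p),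
      σ.toGaloisRep.IsIrreducible → σ'.toGaloisRep.IsIrreducible →
      (∀ x, (σ' x).val.det = (σ x).val.det) →
      (¬ ∃ g : GL (Fin 2) k, ∀ x, ∃ c : k, (g * σ x * g⁻¹).val = c • (σ' x).val) →
      (¬ ∃ X : Matrix (Fin 2) (Fin 2) k, ∀ g, B g = (σ g).val * X - X * (σ' g).val) →
      ρ.IsSymplecticWithMultiplierFun ν →
      (∃ (P : GL (Fin 4) (PadicAlgCl p))
        (rint : Field.absoluteGaloisGroup ℚ →* GL (Fin 4) (Valued.integer (PadicAlgCl p))) (h : GL (Fin 4) k),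
        (∀ g, Matrix.GeneralLinearGroup.map (Valued.integer (PadicAlgCl p)).subtype (rint g) = P⁻¹ * ρ g * P) ∧
        (∀ g, (Matrix.GeneralLinearGroup.map red (rint g)).val =
          h.val * Matrix.reindex finSumFinEquiv finSumFinEquiv
            (Matrix.fromBlocks (σ g).val (B g) 0 (σ' g).val) * (h⁻¹).val)) →
      (∃ (P₂ : GL (Fin 4) (PadicAlgCl p))
        (rint₂ : Field.absoluteGaloisGroup ℚ →* GL (Fin 4) (Valued.integer (PadicAlgCl p))) (h₂ : GL (Fin 4) k),
        (∀ g, Matrix.GeneralLinearGroup.map (Valued.integer (PadicAlgCl p)).subtype (rint₂ g) = P₂⁻¹ * ρ g * P₂) ∧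
        (∀ g, (Matrix.GeneralLinearGroup.map red (rint₂ g)).val =
          h₂.val * Matrix.reindex finSumFinEquiv finSumFinEquiv
            (Matrix.fromBlocks (σ' g).val
              (-(((Matrix.GeneralLinearGroup.det (σ g))⁻¹ : kˣ) : k) • ((σ' g).val * (B g).adjugate * (σ g).val))
              0 (σ g).val) * (h₂⁻¹).val)) ∧
      (¬ ∃ X : Matrix (Fin 2) (Fin 2) k, ∀ g,
        -(((Matrix.GeneralLinearGroup.det (σ g))⁻¹ : kˣ) : k) • ((σ' g).val * (B g).adjugate * (σ g).val) =
          (σ' g).val * X - X * (σ g).val) ∧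
      ∀ (P₃ : GL (Fin 4) (PadicAlgCl p))
        (rint₃ : Field.absoluteGaloisGroup ℚ →* GL (Fin 4) (Valued.integer (PadicAlgCl p))) (h₃ : GL (Fin 4) k)
        (B₃ : Field.absoluteGaloisGroup ℚ → Matrix (Fin 2) (Fin 2) k),
        (∀ g, Matrix.GeneralLinearGroup.map (Valued.integer (PadicAlgCl p)).subtype (rint₃ g) = P₃⁻¹ * ρ g * P₃) →
        (∀ g, (Matrix.GeneralLinearGroup.map red (rint₃ g)).val =
          h₃.val * Matrix.reindex finSumFinEquiv finSumFinEquiv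
            (Matrix.fromBlocks (σ' g).val (B₃ g) 0 (σ g).val) * (h₃⁻¹).val) →
        (¬ ∃ X : Matrix (Fin 2) (Fin 2) k, ∀ g, B₃ g = (σ' g).val * X - X * (σ g).val) →
        ∃ (c : kˣ) (X : Matrix (Fin 2) (Fin 2) k), ∀ g,
          B₃ g = (c : k) • (-(((Matrix.GeneralLinearGroup.det (σ g))⁻¹ : kˣ) : k) •
            ((σ' g).val * (B g).adjugate * (σ g).val)) + ((σ' g).val * X - X * (σ g).val) := by
  intro p _ hp k _ _ _ _ _ red σ σ' ρ B ν hσ hσ' hdet hnt hB hsymp hframe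
  -- (a) the alternating form preserved by `ρ` up to `ν`
  obtain ⟨J, hJT, hJdet, hJ⟩ := (ρ.isSymplecticWithMultiplierFun_iff_det_ne_zero ν).mp hsymp
  -- (b) the multiplier is integral with reduction the common determinant `d g := det (σ̄ g)` (p149860)
  have hunit := Ribet.stub_realiserMultiplierResidual p hp k red σ σ' ρ ν B hσ hσ' hdet hnt hsymp hframe
  obtain ⟨P, rint, h, hP, hred⟩ := hframe
  have hσd : ∀ g, (σ g).val.det = ((Matrix.GeneralLinearGroup.det (σ g) : kˣ) : k) := fun g =>
    (Matrix.GeneralLinearGroup.val_det_apply (σ g)).symm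
  have hσ'd : ∀ g, (σ' g).val.det = ((Matrix.GeneralLinearGroup.det (σ g) : kˣ) : k) := fun g =>
    (hdet g).trans (hσd g)
  have hunit' : ∀ g, ∃ u : Valued.integer (PadicAlgCl p),
      (u : PadicAlgCl p) = ν g ∧ red u = ((Matrix.GeneralLinearGroup.det (σ g) : kˣ) : k) := fun g => by
    obtain ⟨u, hu, hu'⟩ := hunit g
    exact ⟨u, hu, hu'.trans (hσ'd g)⟩
  -- (c) conclusion (i): the dual frame `ν · rint⁻ᵀ` (D1, p165620)
  obtain ⟨P₂, rint₂, h₂, hP₂, hred₂⟩ := stub_dualFrameRealisation p k (Field.absoluteGaloisGroup ℚ) red σ.toMonoidHom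
    σ'.toMonoidHom (fun g => Matrix.GeneralLinearGroup.det (σ g)) B ρ.toMonoidHom P rint h J ν hσd hσ'd hP hred hJT hJdet
    hJ hunit'
  -- (d) conclusion (ii): `B'` is not a coboundary for `(σ̄', σ̄)`, else `B` would be one for `(σ̄, σ̄')` (D2, p164728)
  have hdual := (stub_adjugateDualCocycle k (Field.absoluteGaloisGroup ℚ) σ.toMonoidHom σ'.toMonoidHom
    (fun g => Matrix.GeneralLinearGroup.det (σ g)) hσd hσ'd
    (fun A g => -(((Matrix.GeneralLinearGroup.det (σ g))⁻¹ : kˣ) : k) • ((σ' g).val * (A g).adjugate * (σ g).val))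
    (fun A g => -(((Matrix.GeneralLinearGroup.det (σ g))⁻¹ : kˣ) : k) • ((σ g).val * (A g).adjugate * (σ' g).val))
    (fun _ _ => rfl) (fun _ _ => rfl)).2.2.2.2 B
  have hB' : ¬ ∃ X : Matrix (Fin 2) (Fin 2) k, ∀ g,
      -(((Matrix.GeneralLinearGroup.det (σ g))⁻¹ : kˣ) : k) • ((σ' g).val * (B g).adjugate * (σ g).val) =
        (σ' g).val * X - X * (σ g).val := fun hX => hB (hdual.mpr hX)
  -- (e) conclusion (iii): uniqueness of the realised class for the SWAPPED pair `(σ̄', σ̄)` (p142701)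
  have hnc : ¬ ∃ g : GL (Fin 2) k, ∀ x, g * σ' x * g⁻¹ = σ x := not_conj_swap_of_not_twist (fun x => σ x) (fun x => σ' x) hnt
  refine ⟨⟨P₂, rint₂, h₂, hP₂, hred₂⟩, hB', fun P₃ rint₃ h₃ B₃ hP₃ hred₃ hB₃ => ?_⟩
  exact Ribet.stub_realisedClassUnique p k red σ' σ ρ hσ' hσ hnc P₂ P₃ rint₂ rint₃ h₂ h₃
    (fun g => -(((Matrix.GeneralLinearGroup.det (σ g))⁻¹ : kˣ) : k) • ((σ' g).val * (B g).adjugate * (σ g).val)) B₃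
    hP₂ hred₂ hP₃ hred₃ hB' hB₃

end Summit.Langlands.Langlands.Cruxes.ResiduallyYoshidaLifting.SectorKlingenSplit.Fibre

end
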